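import Summits.QuantumFields.BalabanUV.T4Continuum.Support.NE3SlicePoincareCurved
import Summits.QuantumFields.BalabanUV.T4Continuum.Support.NE3SlicePoincareBudgetLineY
import Summits.QuantumFields.BalabanUV.T4Continuum.Support.MinimalActionRate
import Summits.QuantumFields.BalabanUV.T4Continuum.Support.NE3EnergyRateWSupOfSlicePoincare
import HarnessLib

/-!
# NE3ClassSlicePoincare (T⁴ programme, node NE3, row NE3-R2 × row K6 of route H♮) — THE k-FREE LINE BEHIND THE TWO DISPLAYED
# SMALLNESS CONDITIONS OF (P♮)_W, PART 3: every level at once, and (P♮)_W UNIFORMLY ON THE SMALL-FIELD CLASS WITH ONE CONSTANT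

Row NE3-R2 (`b2b-balaban-t4-ne3r2-p1`, gen 11; K-g11-1 part 3, census D-ne3r2-g11-1; the owner t4-ne3-p1-g24 withdrew his K6 plug-in in
favour of this file, journal l.22137).  WHAT ([folklore]; 0 sorry; 0 def):
* §1 the level dictionary: at level `k` with `LevelSmall d L k x`, every K6 letter of leaf-02's K6c-2b
  `NE3SlicePoincareCurved.slicePoincare_frameFreeBlockLandauW` (p237604) is at most its K-road top in `θ ≥ (L^{k+1})²·x` (row NE3-R2's
  `NE3TopRadiusLetters{,L2}`, `NE3ExactLineSumsTower.DSum_le_top`);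
* §2 **`hSh_of_line` ∕ `hSy_of_line` ∕ `xi_of_line` ∕ `sliceConst_le_line_level`**: K6c-2b's displayed hypotheses `hSh`, `hSy`, K6-Ξ's `hsmall`
  AT EVERY LEVEL `k`, as the named verbatim expressions `shExpr`∕`smallYExpr` of part 1 (which unfold to K6c-2b's texts token for token), from ONE k-free numeric line each (`ShLine ≤ 1∕2`, `SmallYLine ≤ 1∕2`, the Ξ-line), and its constant
  `card n·(16·A·K_h) ≤ CPLine`;
* §3 **`classSlicePoincare_of_lines`**: for `3 ≤ d`, `2 ≤ L`, `1 ≤ N`, class radius `0 < ε ≤ θ`, K1 cut `0 < εc`, row Y9's family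
  `∀ j, LevelSmall d L (j+1) (ε∕(L^{j+2})²)` and FOUR k-FREE NUMERIC LINES in `(d, L, card n, εc, θ)`:
  `∀ j W, W ∈ sfClass d L N ε (j+1) → SlicePoincare L (j+1) W (frameFreeBlockLandauW L N (j+1) W) (CPLine d L (card n) εc θ) (periodBox (N·L^{j+1}))`
  — EXACTLY the hypothesis `hP` of the owner's END `NE3EnergyRateWSupCurved.ne3EnergyRateWSup_sfClass_of_classSlicePoincare` (p238615);
* §4 the four lines and the constant IN NUMBERS at `d = 4`, `L = 2`, `card n ∈ {2, 3}`, `εc = 10⁻¹⁷`, `θ = 10⁻⁵³` (`norm_num`):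
  `SmallYLine = 0.1176…∕0.1886…`, `CPLine ≤ 1234·10¹⁴ ∕ 2776·10¹⁴` — so at `d = 4`, SU(2)∕SU(3), the class-level (P♮)_W carries NO numeric
  hypothesis but `ε ≤ 10⁻⁵³` and row Y9's family.
NOTE (census D-ne3r2-g11-1 (3)): the K1 cut `εc` must NOT be the class radius — the lines pin `εc` to a window (≈ [3·10⁻¹⁸, 2·10⁻¹⁷] at
`θ = 4·10⁻⁵³`); with `εc = ε` they are unsatisfiable.
HONEST FRAMING.  Arithmetic + class plumbing on OUR typed objects; (P♮)_W is leaf-02's theorem (K6c-2b); (ML_w) at `W ≠ 1` and T-E_w♯ follow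
only through the owner's END, whose endpoint charts (`DecomposedRep` ⇐ Π-R, Π-C, Π-L1♮) and (H∃) remain hypotheses; **NE3 is NOT proved**;
spine PROVED 0∕9; finite T⁴ rung (B)+1 — NOT infinite volume, NOT mass gap, NOT BetaPertH, NOT Clay.  ABSOLUTE RULE kept: no printed sentence is
a hypothesis.  PLACEMENT: `Summits/QuantumFields/BalabanUV/`.  HONEST DEPENDENCY: continuum YM on T⁴ ⇐ BetaPertH ∧ nine spine estimates (0/9
proved); BetaPertH ⇐ (D1) ∧ (D4) ∧ CAP+tail; G-an2-4 gates asym, D1 and NE2/3/4.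
-/

set_option autoImplicit false

namespace Summit.QuantumFields.BalabanUV.T4Continuum.NE3ClassSlicePoincare

open Literature.MathematicalPhysics.QuantumFieldTheory.Balaban1983to89
open B7Prop1Explicit B7Prop2Explicit
open T4AveragingDeficitWall (IsUnitaryCfg SmallField)
open T4AveragingDeficitWallBoundary (IsPeriodicCfg periodBox)
open AveragingDeficitTwoLevelPrep (twoLevelSmall prop1Radius)
open AveragingDeficitMultiLevelPrep (tower LevelSmall radIter prop1Radius_nonneg)
open SpreadLift (loopRad)
open BlockAverageVaryHolo (nbRad)
open NE3CovariantLineSumsError (Csup sq_mul_le_prop1Radius iterate_prop1Radius_nonneg)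
open NE3CovariantLineSumsL2 (C2sq)
open NE3CovariantLineSumsL2Tower (rho S2sum S2sum_nonneg)
open NE3ExactLineSumsTower (DSum DSum_le_top DSum_nonneg)
open NE3TopRadiusLetters (radIter_eq_iterate iterate_prop1Radius_le_of_levelSmall loopRad_iterate_le_of_levelSmall E_le_of_levelSmall
  prop1Radius_le_of_twoLevelSmall)
open NE3TopRadiusLettersL2 (S2sum_le_of_levelSmall)
open MinimalActionRate (sfClass)
open NE3SlicePoincareShape (SlicePoincare slicePoincare_mono)
open NE3FrameFreeSliceW (frameFreeBlockLandauW)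
open NE3EnergyRateWSupOfSlicePoincare (tower_eq_mul_pow)
open NE3SlicePoincareCurved (slicePoincare_frameFreeBlockLandauW)
open NE3SlicePoincareBudgetLine NE3SlicePoincareBudgetLineY

noncomputable section

variable {d : ℕ} {n : Type*} [Fintype n] [DecidableEq n]

/-! ## §1 The level dictionary: every K6 letter against `θ ≥ (L^{k+1})²·x` -/

omit [Fintype n] [DecidableEq n] in
/-- `1 ≤ C2sq d L` for `L ≥ 1` (so `√C2sq ≤ C2sq`). [folklore] -/
theorem one_le_C2sq (hd : 1 ≤ d) {L : ℕ} (hL : 1 ≤ L) : 1 ≤ C2sq d L := by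
  unfold C2sq Csup
  have hd1 : (1 : ℝ) ≤ d := by exact_mod_cast hd
  have hL1 : (1 : ℝ) ≤ L := by exact_mod_cast hL
  have hnb : (0 : ℝ) ≤ (nbRad d L : ℝ) := by positivity
  have h1 : (1 : ℝ) ≤ (d : ℝ) ^ 2 := by nlinarith
  have hdL : (0 : ℝ) ≤ (d : ℝ) * L := by positivity
  have hb : (1 : ℝ) ≤ 1250 * ((nbRad d L : ℝ) + L) + 8 * (d * L) + 2 * L := by linarith
  have h2 : (1 : ℝ) ≤ (1250 * ((nbRad d L : ℝ) + L) + 8 * (d * L) + 2 * L) ^ 2 := one_le_pow₀ hb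
  have h3 : (1 : ℝ) ≤ ((2 * nbRad d L + 1 : ℕ) : ℝ) ^ (2 * d) := one_le_pow₀ (by exact_mod_cast (by omega))
  calc (1 : ℝ) = 1 * 1 * 1 := by ring
    _ ≤ (d : ℝ) ^ 2 * (1250 * ((nbRad d L : ℝ) + L) + 8 * (d * L) + 2 * L) ^ 2 * ((2 * nbRad d L + 1 : ℕ) : ℝ) ^ (2 * d) := by
        gcongr

omit [Fintype n] [DecidableEq n] in
/-- **THE LEVEL DICTIONARY** (`1 ≤ d`, `2 ≤ L`, `0 ≤ x`, `LevelSmall d L k x`, `(L^{k+1})²x ≤ θ`): `L ≤ L^{k+1}`; the loop radius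
`0 ≤ lr ≤ lrTop d θ`; the defect sum `0 ≤ DS ≤ 20·lr`; the ℓ² defect sum `0 ≤ S2 ≤ sTop d L θ`; the competitor radius
`0 ≤ aU ≤ (17∕16)²θ` — row NE3-R2's K-g10-1∕2 BY NAME. [folklore] -/
theorem levelDictionary (hd : 1 ≤ d) {L : ℕ} (hL : 2 ≤ L) (k : ℕ) {x θ : ℝ} (hx : 0 ≤ x) (hs : LevelSmall d L k x)
    (hθ : ((L : ℝ) ^ (k + 1)) ^ 2 * x ≤ θ) :
    (L : ℝ) ≤ (L : ℝ) ^ (k + 1) ∧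
    0 ≤ loopRad d L ((prop1Radius d L)^[k] x) ∧ loopRad d L ((prop1Radius d L)^[k] x) ≤ lrTop d θ ∧
    0 ≤ DSum d L (k + 1) x ∧ DSum d L (k + 1) x ≤ 20 * loopRad d L ((prop1Radius d L)^[k] x) ∧
    0 ≤ S2sum d L (k + 1) x ∧ S2sum d L (k + 1) x ≤ sTop d L θ ∧
    0 ≤ radIter d L (k + 1) x ∧ radIter d L (k + 1) x ≤ (17 / 16) ^ 2 * θ := by
  have hL1 : 1 ≤ L := by omega
  have hL1r : (1 : ℝ) ≤ L := by exact_mod_cast hL1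
  have hθ0 : 0 ≤ θ := le_trans (by positivity) hθ
  have hr0 : 0 ≤ (prop1Radius d L)^[k] x := iterate_prop1Radius_nonneg (d := d) k hx
  have hlr0 : 0 ≤ loopRad d L ((prop1Radius d L)^[k] x) := by unfold loopRad; positivity
  have hP0 : (0 : ℝ) ≤ ((d : ℝ) + 1) * ((d : ℝ) + 4) := by positivity
  refine ⟨?_, hlr0, ?_, DSum_nonneg d L (k + 1) hx, ?_, S2sum_nonneg d L (k + 1) hx, ?_,
    by rw [radIter_eq_iterate]; exact iterate_prop1Radius_nonneg (d := d) (k + 1) hx, ?_⟩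
  · calc (L : ℝ) = (L : ℝ) ^ 1 := (pow_one _).symm
      _ ≤ (L : ℝ) ^ (k + 1) := pow_le_pow_right₀ hL1r (by omega)
  · have h := loopRad_iterate_le_of_levelSmall (d := d) hL k hx hs
    unfold lrTop
    exact h.trans (mul_le_mul_of_nonneg_left hθ (by positivity))
  · have h := DSum_le_top (d := d) hL k hx
    have h0 : 0 ≤ (L : ℝ) ^ k * (10 * loopRad d L x) := by unfold loopRad; positivity
    linarith
  · have h := S2sum_le_of_levelSmall (d := d) hL k hx hs
    have hC1 : 1 ≤ C2sq d L := one_le_C2sq hd hL1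
    have hC0 : 0 ≤ C2sq d L := zero_le_one.trans hC1
    have hC : Real.sqrt (C2sq d L) ≤ C2sq d L := (Real.sqrt_le_left hC0).2 (by nlinarith)
    unfold sTop
    calc S2sum d L (k + 1) x ≤ 68 / 3 * (((d : ℝ) + 1) * ((d : ℝ) + 4)) * Real.sqrt (C2sq d L) * (((L : ℝ) ^ (k + 1)) ^ 2 * x) := h
      _ ≤ 68 / 3 * (((d : ℝ) + 1) * ((d : ℝ) + 4)) * C2sq d L * θ := by
          have hs0 : 0 ≤ Real.sqrt (C2sq d L) := Real.sqrt_nonneg _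
          have hθ1 : 0 ≤ ((L : ℝ) ^ (k + 1)) ^ 2 * x := by positivity
          gcongr
  · rw [radIter_eq_iterate, Function.iterate_succ_apply']
    have htop : twoLevelSmall d L * (prop1Radius d L)^[k] x ≤ 1 := NE3CovariantLineSumsError.LevelSmall.top hs
    have h1 := prop1Radius_le_of_twoLevelSmall (d := d) hL hr0 htop
    have h2 := iterate_prop1Radius_le_of_levelSmall (d := d) hL k hx hs
    calc prop1Radius d L ((prop1Radius d L)^[k] x) ≤ 17 / 16 * ((L : ℝ) ^ 2 * (prop1Radius d L)^[k] x) := h1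
      _ ≤ 17 / 16 * ((L : ℝ) ^ 2 * (17 / 16 * (((L : ℝ) ^ 2) ^ k * x))) := by gcongr
      _ = (17 / 16) ^ 2 * (((L : ℝ) ^ (k + 1)) ^ 2 * x) := by ring
      _ ≤ (17 / 16) ^ 2 * θ := by gcongr

omit [Fintype n] [DecidableEq n] in
/-- `L^d·(L^k)² = L^{d−2}·(L^{k+1})²` (`d ≥ 2`): the letter `Λ` of K6c-2b in the form part 2 wants. [folklore] -/
theorem lambda_eq (hd : 2 ≤ d) (L k : ℕ) : (L : ℝ) ^ d * ((L : ℝ) ^ k) ^ 2 = (L : ℝ) ^ (d - 2) * ((L : ℝ) ^ (k + 1)) ^ 2 := by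
  have hd2 : d = (d - 2) + 2 := by omega
  conv_lhs => rw [hd2]
  ring

/-! ## §2 K6c-2b's displayed numeric hypotheses at every level from one k-free line each -/

omit [Fintype n] [DecidableEq n] in
/-- **`hSh` AT LEVEL `k` FROM THE LINE** (`1 ≤ d`, `2 ≤ L`, `0 ≤ x`, `LevelSmall d L k x`, `(L^{k+1})²x ≤ θ`, `1 ≤ c`, `0 < ε`,
`ShLine d L c ε θ ≤ 1∕2`): the conclusion unfolds to K6c-2b's hypothesis `hSh` token for token (`c := card n`). [folklore] -/
theorem hSh_of_line (hd : 1 ≤ d) {L c : ℕ} (hL : 2 ≤ L) (k : ℕ) {x θ ε : ℝ} (hx : 0 ≤ x) (hs : LevelSmall d L k x)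
    (hθ : ((L : ℝ) ^ (k + 1)) ^ 2 * x ≤ θ) (hc : 1 ≤ (c : ℝ)) (hε : 0 < ε) (hline : ShLine d L c ε θ ≤ 1 / 2) :
    shExpr d c ((L : ℝ) ^ (k + 1)) x (loopRad d L ((prop1Radius d L)^[k] x)) (DSum d L (k + 1) x) ε ≤ 1 / 2 := by
  obtain ⟨hLM, hlr0, hlr, hDS0, hDS, -, -, -, -⟩ := levelDictionary hd hL k hx hs hθ
  have hL2 : (2 : ℝ) ≤ L := by exact_mod_cast hL
  exact (Sh_le_line hd hL2 hLM hx hθ hlr0 hlr hDS0 hDS hc hε).trans hline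

omit [Fintype n] [DecidableEq n] in
/-- **`hSy` AT LEVEL `k` FROM THE LINE** (`2 ≤ d`, rest as `hSh_of_line`, `SmallYLine d L c ε θ ≤ 1∕2`): the conclusion unfolds to
K6c-2b's hypothesis `hSy` token for token (`c := card n`). [folklore] -/
theorem hSy_of_line (hd : 2 ≤ d) {L c : ℕ} (hL : 2 ≤ L) (k : ℕ) {x θ ε : ℝ} (hx : 0 ≤ x) (hs : LevelSmall d L k x)
    (hθ : ((L : ℝ) ^ (k + 1)) ^ 2 * x ≤ θ) (hc : 1 ≤ (c : ℝ)) (hε : 0 < ε) (hline : SmallYLine d L c ε θ ≤ 1 / 2) :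
    smallYExpr d L c ((L : ℝ) ^ (k + 1)) x (loopRad d L ((prop1Radius d L)^[k] x)) (DSum d L (k + 1) x) (S2sum d L (k + 1) x) ((L : ℝ) ^ d * ((L : ℝ) ^ k) ^ 2) (radIter d L (k + 1) x) ε ≤ 1 / 2 := by
  have hd1 : 1 ≤ d := by omega
  obtain ⟨hLM, hlr0, hlr, hDS0, hDS, hS20, hS2, haU0, haU⟩ := levelDictionary hd1 hL k hx hs hθ
  have hL2 : (2 : ℝ) ≤ L := by exact_mod_cast hL
  exact (smallY_le_line hd hL2 hLM hx hθ hlr0 hlr hDS0 hDS hS20 hS2 (lambda_eq hd L k) haU0 haU hc hε).trans hline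

omit [Fintype n] [DecidableEq n] in
/-- **K6-Ξ's `hsmall` AT LEVEL `k` FROM THE Ξ-LINE** (`1 ≤ d`, `2 ≤ L`, `0 ≤ x`, `LevelSmall d L k x`, `(L^{k+1})²x ≤ θ`, `0 ≤ c`,
`8d((d−1)θ)² + 2·c·((4d² + 272d(d+1)(d+4))θ)² ≤ 1∕2`): K6c-2b's hypothesis `hsmall` token for token (`c := card n`; the E-letter by row
NE3-R2's `E_le_of_levelSmall`). [folklore] -/
theorem xi_of_line (hd : 1 ≤ d) {L c : ℕ} (hL : 2 ≤ L) (k : ℕ) {x θ : ℝ} (hx : 0 ≤ x) (hs : LevelSmall d L k x)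
    (hθ : ((L : ℝ) ^ (k + 1)) ^ 2 * x ≤ θ)
    (hline : 8 * d * (((d : ℝ) - 1) * θ) ^ 2
      + 2 * ((c : ℝ) * ((4 * (d : ℝ) ^ 2 + 272 * d * (((d : ℝ) + 1) * ((d : ℝ) + 4))) * θ) ^ 2) ≤ 1 / 2) :
    8 * d * (((L : ℝ) ^ (k + 1)) * (((d : ℝ) - 1) * (((L : ℝ) ^ (k + 1)) - 1) * x)) ^ 2
      + 2 * (c * (4 * (d : ℝ) ^ 2 * ((L : ℝ) ^ (k + 1) - 1) ^ 2 * x + 16 * d * loopRad d L ((prop1Radius d L)^[k] x)) ^ 2)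
        ≤ 1 / 2 := by
  have hL1 : (1 : ℝ) ≤ L := by exact_mod_cast (show 1 ≤ L by omega)
  have hM : (1 : ℝ) ≤ (L : ℝ) ^ (k + 1) := one_le_pow₀ hL1
  obtain ⟨hθ0, -, hMMx, -⟩ := atoms hM hx hθ
  have hd1 : (1 : ℝ) ≤ d := by exact_mod_cast hd
  have hdm : (0 : ℝ) ≤ (d : ℝ) - 1 := by linarith
  have hE := E_le_of_levelSmall (d := d) hL k hx hs
  have hE0 : 0 ≤ 4 * (d : ℝ) ^ 2 * ((L : ℝ) ^ (k + 1) - 1) ^ 2 * x + 16 * d * loopRad d L ((prop1Radius d L)^[k] x) := by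
    have : 0 ≤ loopRad d L ((prop1Radius d L)^[k] x) := by
      unfold loopRad; have := iterate_prop1Radius_nonneg (d := d) (L := L) k hx; positivity
    positivity
  have hE' : 4 * (d : ℝ) ^ 2 * ((L : ℝ) ^ (k + 1) - 1) ^ 2 * x + 16 * d * loopRad d L ((prop1Radius d L)^[k] x)
      ≤ (4 * (d : ℝ) ^ 2 + 272 * d * (((d : ℝ) + 1) * ((d : ℝ) + 4))) * θ :=
    hE.trans (mul_le_mul_of_nonneg_left hθ (by positivity))
  have hcx : ((L : ℝ) ^ (k + 1)) * (((d : ℝ) - 1) * (((L : ℝ) ^ (k + 1)) - 1) * x) ≤ ((d : ℝ) - 1) * θ := by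
    have e : ((L : ℝ) ^ (k + 1)) * (((d : ℝ) - 1) * (((L : ℝ) ^ (k + 1)) - 1) * x)
        = ((d : ℝ) - 1) * ((((L : ℝ) ^ (k + 1)) - 1) * ((L : ℝ) ^ (k + 1)) * x) := by ring
    rw [e]; exact mul_le_mul_of_nonneg_left hMMx hdm
  have hcx0 : 0 ≤ ((L : ℝ) ^ (k + 1)) * (((d : ℝ) - 1) * (((L : ℝ) ^ (k + 1)) - 1) * x) :=
    mul_nonneg (by positivity) (mul_nonneg (mul_nonneg hdm (by linarith)) hx)
  have hc0 : (0 : ℝ) ≤ c := by positivity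
  refine le_trans ?_ hline
  gcongr

/-- **THE SLICE CONSTANT AT LEVEL `k` AGAINST THE LINE**: `card n·(16·A·K_h) ≤ CPLine d L (card n) ε θ` — K6c-2b's constant token for
token. [folklore] -/
theorem sliceConst_le_line_level (hd : 1 ≤ d) {L c : ℕ} (hL : 2 ≤ L) (k : ℕ) {x θ ε : ℝ} (hx : 0 ≤ x) (hs : LevelSmall d L k x)
    (hθ : ((L : ℝ) ^ (k + 1)) ^ 2 * x ≤ θ) (hc : 1 ≤ (c : ℝ)) (hε : 0 < ε) :
    (c : ℝ) * cpExpr d L c ((L : ℝ) ^ (k + 1)) x (loopRad d L ((prop1Radius d L)^[k] x)) (DSum d L (k + 1) x) ε ≤ CPLine d L c ε θ := by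
  obtain ⟨hLM, hlr0, hlr, hDS0, hDS, -, -, -, -⟩ := levelDictionary hd hL k hx hs hθ
  have hL2 : (2 : ℝ) ≤ L := by exact_mod_cast hL
  exact sliceConst_le_line hd hL2 hLM hx hθ hlr0 hlr hDS0 hDS hc hε

/-! ## §3 (P♮)_W uniformly on the small-field class with ONE constant, under four k-free numeric lines -/

/-- **(P♮)_W ON THE WHOLE SMALL-FIELD CLASS, EVERY LEVEL, ONE CONSTANT** (`3 ≤ d`, `2 ≤ L`, `1 ≤ N`; class radius `0 < ε ≤ θ`; K1 cut
`0 < εc`; row Y9's family `∀ j, LevelSmall d L (j+1) (ε∕(L^{j+2})²)`; the four k-FREE numeric lines `ShLine ≤ 1∕2`, `SmallYLine ≤ 1∕2`,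
`(68∕3)(d+1)(d+4)·C2sq·θ ≤ ρ∕2`, `8d((d−1)θ)² + 2·card n·((4d²+272d(d+1)(d+4))θ)² ≤ 1∕2`):
`∀ j W, W ∈ sfClass d L N ε (j+1) → SlicePoincare L (j+1) W (frameFreeBlockLandauW L N (j+1) W) (CPLine d L (card n) εc θ) (periodBox (N·L^{j+1}))`
— leaf-02's K6c-2b at `x_j = ε∕(L^{j+1})²` (so `(L^{j+1})²·x_j = ε`), its five numeric hypotheses by §2, its constant by
`sliceConst_le_line_level` + `slicePoincare_mono`.  This is the hypothesis `hP` of the owner's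
`NE3EnergyRateWSupCurved.ne3EnergyRateWSup_sfClass_of_classSlicePoincare`. [folklore] -/
theorem classSlicePoincare_of_lines [Nonempty n] (hd : 3 ≤ d) {L N : ℕ} (hL : 2 ≤ L) (hN : 1 ≤ N) {ε θ εc : ℝ}
    (hε : 0 < ε) (hεθ : ε ≤ θ) (hεc : 0 < εc)
    (hsmall : ∀ j : ℕ, LevelSmall d L (j + 1) (ε / ((L : ℝ) ^ (j + 2)) ^ 2))
    (h1 : ShLine d L (Fintype.card n) εc θ ≤ 1 / 2) (h2 : SmallYLine d L (Fintype.card n) εc θ ≤ 1 / 2)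
    (h3 : 68 / 3 * (((d : ℝ) + 1) * ((d : ℝ) + 4)) * C2sq d L * θ ≤ rho d L / 2)
    (h4 : 8 * d * (((d : ℝ) - 1) * θ) ^ 2
      + 2 * ((Fintype.card n : ℝ) * ((4 * (d : ℝ) ^ 2 + 272 * d * (((d : ℝ) + 1) * ((d : ℝ) + 4))) * θ) ^ 2) ≤ 1 / 2) :
    ∀ j : ℕ, ∀ W : Site d → Fin d → (Matrix n n ℂ)ˣ, W ∈ sfClass d L N ε (j + 1) →
      SlicePoincare L (j + 1) W (frameFreeBlockLandauW L N (j + 1) W) (CPLine d L (Fintype.card n) εc θ)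
        (periodBox (N * L ^ (j + 1))) := by
  intro j W hW
  obtain ⟨hWu, hWP, hWx⟩ := hW
  have hd1 : 1 ≤ d := by omega
  have hd2 : 2 ≤ d := by omega
  have hL1 : 1 ≤ L := by omega
  have hL0 : (0 : ℝ) < L := by exact_mod_cast (show 0 < L by omega)
  have hM0 : (0 : ℝ) < (L : ℝ) ^ (j + 1) := by positivity
  have hc : (1 : ℝ) ≤ (Fintype.card n : ℝ) := by exact_mod_cast Fintype.card_pos
  -- the level radius `x_j = ε∕(L^{j+1})²`, `(L^{j+1})²·x_j = ε ≤ θ`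
  have hx : 0 ≤ ε / ((L : ℝ) ^ (j + 1)) ^ 2 := by positivity
  have hθ : ((L : ℝ) ^ (j + 1)) ^ 2 * (ε / ((L : ℝ) ^ (j + 1)) ^ 2) ≤ θ := by
    have e : ((L : ℝ) ^ (j + 1)) ^ 2 * (ε / ((L : ℝ) ^ (j + 1)) ^ 2) = ε := by field_simp
    rw [e]; exact hεθ
  -- row Y9's family one notch down: `LevelSmall d L j x_j`
  have hs : LevelSmall d L j (ε / ((L : ℝ) ^ (j + 1)) ^ 2) := by
    have hy : 0 ≤ ε / ((L : ℝ) ^ (j + 2)) ^ 2 := by positivity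
    have hxy : ε / ((L : ℝ) ^ (j + 1)) ^ 2 ≤ prop1Radius d L (ε / ((L : ℝ) ^ (j + 2)) ^ 2) := by
      have e : ε / ((L : ℝ) ^ (j + 1)) ^ 2 = (L : ℝ) ^ 2 * (ε / ((L : ℝ) ^ (j + 2)) ^ 2) := by
        field_simp; ring
      rw [e]; exact sq_mul_le_prop1Radius (d := d) L _
    exact AveragingDeficitMultiLevelPrep.LevelSmall.mono (d := d) hx hxy (hsmall j).2
  -- the period
  have hWP' : IsPeriodicCfg W ((tower L N (j + 1) : ℕ) : ℤ) := by rwa [tower_eq_mul_pow]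
  -- `hS2`, K6-Ξ, `hSh`, `hSy` from the lines
  have hS2 : S2sum d L (j + 1) (ε / ((L : ℝ) ^ (j + 1)) ^ 2) ≤ rho d L / 2 := by
    obtain ⟨-, -, -, -, -, -, hS2, -, -⟩ := levelDictionary hd1 hL j hx hs hθ
    unfold sTop at hS2
    exact hS2.trans h3
  have hxi := xi_of_line (c := Fintype.card n) hd1 hL j hx hs hθ h4
  have hSh := hSh_of_line hd1 hL j hx hs hθ hc hεc h1
  have hSy := hSy_of_line hd2 hL j hx hs hθ hc hεc h2
  have hP := slicePoincare_frameFreeBlockLandauW hd hL hN j hWu hWP' hx hs hWx hS2 hxi hεc hSh hSy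
  exact slicePoincare_mono hP (sliceConst_le_line_level hd1 hL j hx hs hθ hc hεc)

/-! ## §4 The lines in numbers: `d = 4`, `L = 2`, SU(2) and SU(3), `εc = 10⁻¹⁷`, `θ = 10⁻⁵³` -/

omit [Fintype n] [DecidableEq n] in
/-- `C2sq 4 2 = 311 602 316 992²` and `rho 4 2 = 1∕2`. [folklore] -/
theorem C2sq_four_two : C2sq 4 2 = 97096003954782851928064 ∧ rho 4 2 = 1 / 2 := by
  constructor
  · unfold C2sq Csup nbRad; norm_num
  · unfold rho
    rw [show ((2 : ℕ) : ℝ) ^ 2 / ((2 : ℕ) : ℝ) ^ 4 = (1 / 2) ^ 2 by norm_num]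
    exact Real.sqrt_sq (by norm_num)

omit [Fintype n] [DecidableEq n] in
/-- **THE FOUR LINES AND THE CONSTANT AT `d = 4`, `L = 2`, `card n = 2`, `εc = 10⁻¹⁷`, `θ = 10⁻⁵³`** (D-ne3r2-g11-1: `SmallYLine ≈ 0.1176`,
`CPLine ≈ 1.2338·10¹⁷`). [folklore] -/
theorem lines_d4_L2_c2 :
    ShLine 4 2 2 (1 / 10 ^ 17) (1 / 10 ^ 53) ≤ 1 / 2 ∧ SmallYLine 4 2 2 (1 / 10 ^ 17) (1 / 10 ^ 53) ≤ 1 / 2 ∧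
    68 / 3 * ((((4 : ℕ) : ℝ) + 1) * (((4 : ℕ) : ℝ) + 4)) * C2sq 4 2 * (1 / 10 ^ 53) ≤ rho 4 2 / 2 ∧
    8 * ((4 : ℕ) : ℝ) * ((((4 : ℕ) : ℝ) - 1) * (1 / 10 ^ 53)) ^ 2
      + 2 * (((2 : ℕ) : ℝ) * ((4 * ((4 : ℕ) : ℝ) ^ 2 + 272 * ((4 : ℕ) : ℝ) * ((((4 : ℕ) : ℝ) + 1) * (((4 : ℕ) : ℝ) + 4))) * (1 / 10 ^ 53)) ^ 2)
        ≤ 1 / 2 ∧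
    CPLine 4 2 2 (1 / 10 ^ 17) (1 / 10 ^ 53) ≤ 1234 * 10 ^ 14 := by
  obtain ⟨hC, hρ⟩ := C2sq_four_two
  refine ⟨?_, ?_, ?_, ?_, ?_⟩
  · unfold ShLine ALine qTop cfTop lrTop; norm_num
  · unfold SmallYLine KhLine SyLine sTwoLine gTop bhTop byTop gzTop kTop dkTop pkTop sTop ALine qTop cfTop cjTop wTop lrTop
    rw [hC]; norm_num
  · rw [hC, hρ]; norm_num
  · norm_num
  · unfold CPLine KhLine ALine gTop bhTop qTop cfTop cjTop wTop lrTop; norm_num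

omit [Fintype n] [DecidableEq n] in
/-- **THE SAME AT `card n = 3`** (SU(3); `SmallYLine ≈ 0.1886`, `CPLine ≈ 2.776·10¹⁷`). [folklore] -/
theorem lines_d4_L2_c3 :
    ShLine 4 2 3 (1 / 10 ^ 17) (1 / 10 ^ 53) ≤ 1 / 2 ∧ SmallYLine 4 2 3 (1 / 10 ^ 17) (1 / 10 ^ 53) ≤ 1 / 2 ∧
    8 * ((4 : ℕ) : ℝ) * ((((4 : ℕ) : ℝ) - 1) * (1 / 10 ^ 53)) ^ 2
      + 2 * (((3 : ℕ) : ℝ) * ((4 * ((4 : ℕ) : ℝ) ^ 2 + 272 * ((4 : ℕ) : ℝ) * ((((4 : ℕ) : ℝ) + 1) * (((4 : ℕ) : ℝ) + 4))) * (1 / 10 ^ 53)) ^ 2)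
        ≤ 1 / 2 ∧
    CPLine 4 2 3 (1 / 10 ^ 17) (1 / 10 ^ 53) ≤ 2776 * 10 ^ 14 := by
  obtain ⟨hC, -⟩ := C2sq_four_two
  refine ⟨?_, ?_, ?_, ?_⟩
  · unfold ShLine ALine qTop cfTop lrTop; norm_num
  · unfold SmallYLine KhLine SyLine sTwoLine gTop bhTop byTop gzTop kTop dkTop pkTop sTop ALine qTop cfTop cjTop wTop lrTop
    rw [hC]; norm_num
  · norm_num
  · unfold CPLine KhLine ALine gTop bhTop qTop cfTop cjTop wTop lrTop; norm_num

/-- **(P♮)_W ON THE CLASS AT `d = 4`, `L = 2`, SU(2), WITH NO NUMERIC HYPOTHESIS BUT `ε ≤ 10⁻⁵³`** (K1 cut `εc := 10⁻¹⁷`, constant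
`CPLine 4 2 2 10⁻¹⁷ 10⁻⁵³ ≤ 1234·10¹⁴`). [folklore] -/
theorem classSlicePoincare_SU2 [Nonempty n] (hn : Fintype.card n = 2) {N : ℕ} (hN : 1 ≤ N) {ε : ℝ} (hε : 0 < ε)
    (hε' : ε ≤ 1 / 10 ^ 53) (hsmall : ∀ j : ℕ, LevelSmall 4 2 (j + 1) (ε / (((2 : ℕ) : ℝ) ^ (j + 2)) ^ 2)) :
    ∀ j : ℕ, ∀ W : Site 4 → Fin 4 → (Matrix n n ℂ)ˣ, W ∈ sfClass 4 2 N ε (j + 1) →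
      SlicePoincare 2 (j + 1) W (frameFreeBlockLandauW 2 N (j + 1) W) (CPLine 4 2 2 (1 / 10 ^ 17) (1 / 10 ^ 53))
        (periodBox (N * 2 ^ (j + 1))) := by
  obtain ⟨h1, h2, h3, h4, -⟩ := lines_d4_L2_c2
  have h := classSlicePoincare_of_lines (n := n) (d := 4) (L := 2) (by norm_num) (by norm_num) hN hε hε'
    (by norm_num : (0 : ℝ) < 1 / 10 ^ 17) hsmall
  rw [hn] at h
  exact h h1 h2 h3 h4

end

end Summit.QuantumFields.BalabanUV.T4Continuum.NE3ClassSlicePoincare
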